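import Summits.ValiantsHypothesis.ValiantsHypothesis.Theorems.KPlusLogSqLawTropicalBRefreshExclusivity

/-!
# Route «KPlusLogSqLaw», crux `TropicalB` (stmt-ValiantsHypothesis-19771) — TOP CELLS ARE STICKY:
# a dominant term whose classes off one column all have maximal exponent FREEZES its cell in that column
# (every later dominant term through that cell is the same term up to that cell's class); level form and bottom dual

HONEST FRAMING.  Structure helper (cell `pub-symmetroid`, seat val-sym-trop-p3 g11, 2026-08-28; `--supports stmt-ValiantsHypothesis-19771
--as helper`, line `Cruxes/TropicalB/Lines/birth.lean`) toward the registered stubs `stub_tropThin` / `stub_tropFat` of the OPEN crux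
`Summit.ValiantsHypothesis.ValiantsHypothesis.Theses.KPlusLogSqLaw.TropicalB`.  Elementary corollaries (pigeonhole) of the ONE-COLUMN EXCHANGE
`RefreshExclusivity.erase_sum_lt_of_dominant` (val-sym-trop-p4 g4), valid for EVERY design of every format `(m, K)`, all exponents, all
valuations; they bound nothing by themselves and bear on neither `TropicalB` in its window, `WeakLifting`, DoorA26 / DoorA34, `MatrixDescartes`
(stmt-ValiantsHypothesis-18050) nor VP ≠ VNP.

THE LAWS (`P` dominant at `θ`, `Q` dominant at `θ' > θ`, both using the same cell in column `b₀`, i.e. `Q.1 b₀ = P.1 b₀`).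
* `exists_lt_of_sameCell` — unless `Q` equals `P` off `b₀`, some OTHER column carries at `Q` a class of strictly larger exponent than at `P`
  (pigeonhole on `erase_sum_lt_of_dominant`: the exponent mass off `b₀` strictly increases).  Level form `exists_gt_of_sameCell`: if every
  class of `P` off `b₀` has exponent `≥ D`, then `Q` carries a class of exponent `> D` off `b₀` — a permutation sharing a cell with a term that is
  «at level `D`» off that cell can only come back ABOVE level `D`.
* `eq_off_of_top` — **TOP CELLS ARE STICKY**: if every class of `P` off `b₀` has MAXIMAL exponent (`d l ≤ d (P.2 i)` for all `l`, `i ≠ b₀`), then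
  `Q.1 = P.1` and `Q.2 = P.2` off `b₀`: the cell `(P.1 b₀, b₀)` is frozen for the rest of the chain — every later term through it is `P` with at most
  the class at `b₀` raised.  In particular (`perm_eq_of_top`, `ne_mul_swap_of_top`) no OTHER permutation through that cell occurs later; at
  `m = 3`: a dominant term with two top-exponent cells retires its transposition neighbour across the third column for the rest of the chain.
* `eq_off_of_bottom` — the time-reversed dual: if the LATER term `Q` carries classes of MINIMAL exponent off `b₀`, every EARLIER dominant term
  through the same cell equals `Q` off `b₀`.
* chain currency (`StrictMono θ`, all terms dominant): `chain_exists_gt_of_sameCell`, `chain_eq_off_of_top`, `chain_ne_mul_swap_of_top`.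

READING (located, seat memo HOME/val-sym-trop-p3/g11/C3-LANE-g11.md; not a theorem about `T(3,K)`).  At `m = 3` the six permutations are the six
LINES of a `3 × 3` grid whose cells are the nine matrix cells (even permutations = one ruling, odd = the other; two permutations share a cell iff
they differ by a column transposition), and the pairwise exchange law is exactly: slopes increase, cell classes increase, and across every cell the
two lines through it LEAPFROG in off-cell exponent mass (`erase_sum_lt_of_dominant`).  On lacunary exponents the chain is graded by its top class
(«levels»); `exists_gt_of_sameCell` is the LEVEL KILL («a line meeting a term with two level-top cells is dead for the rest of the level») that
drives the located `11`-terms-per-level schedules of this lineage (9 unit raises + 2 rides per level; kernel words …ThreeRowNineteen /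
…ThreeRowTwentyThree), where one line is dead in every level.  [folklore-level corollaries of the tree's exchange law; the packaging is this cell's]
-/

set_option linter.dupNamespace false
set_option autoImplicit false

namespace Summit.ValiantsHypothesis.ValiantsHypothesis.Theorems.KPlusLogSqLaw

open Summit.ValiantsHypothesis.ValiantsHypothesis.Theorems.MatrixDescartes.Negative
open Finset

namespace TopSticky

section Terms

variable {m K : ℕ} (d : Fin K → ℕ) (v ε : Fin m → Fin m → Fin K → ℤ)

/-- **Leapfrog through a shared cell, pigeonhole form.**  `P` dominant at `θ`, `Q` dominant at `θ' > θ`, same cell in column `b₀`, and `Q`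
differs from `P` somewhere off `b₀` (in permutation or class): then some column `i ≠ b₀` carries at `Q` a class of strictly larger exponent
than at `P`. [folklore; from `RefreshExclusivity.erase_sum_lt_of_dominant`] -/
theorem exists_lt_of_sameCell {θ θ' : ℤ} (hθ : θ < θ') {p q : Equiv.Perm (Fin m) × (Fin m → Fin K)} (b₀ : Fin m)
    (hcol : q.1 b₀ = p.1 b₀) (hdiff : p.1 ≠ q.1 ∨ ∃ i, i ≠ b₀ ∧ p.2 i ≠ q.2 i)
    (hp : IsDominant d v ε θ p) (hq : IsDominant d v ε θ' q) :
    ∃ i, i ≠ b₀ ∧ d (p.2 i) < d (q.2 i) := by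
  by_contra h
  push Not at h
  have hlt := RefreshExclusivity.erase_sum_lt_of_dominant d v ε hθ b₀ hcol hdiff hp hq
  have hle : ∑ i ∈ univ.erase b₀, (d (q.2 i) : ℤ) ≤ ∑ i ∈ univ.erase b₀, (d (p.2 i) : ℤ) :=
    Finset.sum_le_sum fun i hi => by exact_mod_cast h i (Finset.ne_of_mem_erase hi)
  exact absurd hlt (not_lt.mpr hle)

/-- **Level form.**  If every class of the earlier term `P` off `b₀` has exponent `≥ D`, a later dominant term `Q` through the same cell
(and different from `P` off `b₀`) carries, off `b₀`, a class of exponent `> D`. [folklore] -/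
theorem exists_gt_of_sameCell {θ θ' : ℤ} (hθ : θ < θ') {p q : Equiv.Perm (Fin m) × (Fin m → Fin K)} (b₀ : Fin m)
    (hcol : q.1 b₀ = p.1 b₀) (hdiff : p.1 ≠ q.1 ∨ ∃ i, i ≠ b₀ ∧ p.2 i ≠ q.2 i) {D : ℕ} (hD : ∀ i, i ≠ b₀ → D ≤ d (p.2 i))
    (hp : IsDominant d v ε θ p) (hq : IsDominant d v ε θ' q) :
    ∃ i, i ≠ b₀ ∧ D < d (q.2 i) := by
  obtain ⟨i, hi, hlt⟩ := exists_lt_of_sameCell d v ε hθ b₀ hcol hdiff hp hq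
  exact ⟨i, hi, (hD i hi).trans_lt hlt⟩

/-- **TOP CELLS ARE STICKY.**  If every class of `P` off `b₀` has maximal exponent, every later dominant term through `P`'s cell in column `b₀`
has the same permutation as `P` and the same classes off `b₀`. [folklore] -/
theorem eq_off_of_top {θ θ' : ℤ} (hθ : θ < θ') {p q : Equiv.Perm (Fin m) × (Fin m → Fin K)} (b₀ : Fin m)
    (hcol : q.1 b₀ = p.1 b₀) (htop : ∀ i, i ≠ b₀ → ∀ l : Fin K, d l ≤ d (p.2 i))
    (hp : IsDominant d v ε θ p) (hq : IsDominant d v ε θ' q) :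
    q.1 = p.1 ∧ ∀ i, i ≠ b₀ → q.2 i = p.2 i := by
  by_contra h
  have hdiff : p.1 ≠ q.1 ∨ ∃ i, i ≠ b₀ ∧ p.2 i ≠ q.2 i := by
    by_cases h1 : p.1 = q.1
    · right
      by_contra h2
      push Not at h2
      exact h ⟨h1.symm, fun i hi => (h2 i hi).symm⟩
    · exact Or.inl h1
  obtain ⟨i, hi, hlt⟩ := exists_lt_of_sameCell d v ε hθ b₀ hcol hdiff hp hq
  exact absurd (htop i hi (q.2 i)) (not_le.mpr hlt)

/-- Sticky top cells, permutation form: no OTHER permutation passes later through the frozen cell. [folklore] -/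
theorem perm_eq_of_top {θ θ' : ℤ} (hθ : θ < θ') {p q : Equiv.Perm (Fin m) × (Fin m → Fin K)} (b₀ : Fin m)
    (hcol : q.1 b₀ = p.1 b₀) (htop : ∀ i, i ≠ b₀ → ∀ l : Fin K, d l ≤ d (p.2 i))
    (hp : IsDominant d v ε θ p) (hq : IsDominant d v ε θ' q) : q.1 = p.1 :=
  (eq_off_of_top d v ε hθ b₀ hcol htop hp hq).1

/-- Sticky top cells, transposition form: the neighbour `P.1 * swap b b'` (`b, b' ≠ b₀`, `b ≠ b'`), which uses `P`'s cell in column `b₀`, never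
occurs later with any classes.  At `m = 3` (`{b₀, b, b'}` = all columns): a dominant term with two top-exponent cells retires its transposition
neighbour across the third column for the rest of the chain. [folklore] -/
theorem ne_mul_swap_of_top {θ θ' : ℤ} (hθ : θ < θ') {p q : Equiv.Perm (Fin m) × (Fin m → Fin K)} (b₀ b b' : Fin m)
    (hb : b ≠ b₀) (hb' : b' ≠ b₀) (hbb' : b ≠ b') (htop : ∀ i, i ≠ b₀ → ∀ l : Fin K, d l ≤ d (p.2 i))
    (hp : IsDominant d v ε θ p) (hq : IsDominant d v ε θ' q) : q.1 ≠ p.1 * Equiv.swap b b' := by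
  intro hq1
  have hcol : q.1 b₀ = p.1 b₀ := by
    rw [hq1, Equiv.Perm.mul_apply, Equiv.swap_apply_of_ne_of_ne hb.symm hb'.symm]
  have h := perm_eq_of_top d v ε hθ b₀ hcol htop hp hq
  rw [hq1] at h
  have h2 : (p.1 * Equiv.swap b b') b = p.1 b := by rw [h]
  rw [Equiv.Perm.mul_apply, Equiv.swap_apply_left] at h2
  exact hbb' (p.1.injective h2).symm

/-- **Bottom dual** (time reversed): if the LATER term `Q` carries classes of minimal exponent off `b₀`, every earlier dominant term through the
same cell equals `Q` off `b₀`. [folklore] -/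
theorem eq_off_of_bottom {θ θ' : ℤ} (hθ : θ < θ') {p q : Equiv.Perm (Fin m) × (Fin m → Fin K)} (b₀ : Fin m)
    (hcol : q.1 b₀ = p.1 b₀) (hbot : ∀ i, i ≠ b₀ → ∀ l : Fin K, d (q.2 i) ≤ d l)
    (hp : IsDominant d v ε θ p) (hq : IsDominant d v ε θ' q) :
    p.1 = q.1 ∧ ∀ i, i ≠ b₀ → p.2 i = q.2 i := by
  by_contra h
  have hdiff : p.1 ≠ q.1 ∨ ∃ i, i ≠ b₀ ∧ p.2 i ≠ q.2 i := by
    by_cases h1 : p.1 = q.1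
    · right
      by_contra h2
      push Not at h2
      exact h ⟨h1, h2⟩
    · exact Or.inl h1
  obtain ⟨i, hi, hlt⟩ := exists_lt_of_sameCell d v ε hθ b₀ hcol hdiff hp hq
  exact absurd (hbot i hi (p.2 i)) (not_le.mpr hlt)

end Terms

/-! ## Chain currency -/

section Chain

variable {m K n : ℕ} (d : Fin K → ℕ) (v ε : Fin m → Fin m → Fin K → ℤ) (θ : Fin (n + 1) → ℤ)
  (p : Fin (n + 1) → Equiv.Perm (Fin m) × (Fin m → Fin K))

/-- Along a dominant chain: a later term through the cell of term `i` in column `b₀`, different from it off `b₀`, carries off `b₀` a class of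
exponent above any common lower bound `D` of term `i`'s exponents off `b₀` («a line can only come back above the level»). [folklore] -/
theorem chain_exists_gt_of_sameCell (hθ : StrictMono θ) (hdom : ∀ k, IsDominant d v ε (θ k) (p k)) {i j : Fin (n + 1)}
    (hij : i < j) (b₀ : Fin m) (hcell : (p j).1 b₀ = (p i).1 b₀)
    (hdiff : (p i).1 ≠ (p j).1 ∨ ∃ b, b ≠ b₀ ∧ (p i).2 b ≠ (p j).2 b) {D : ℕ} (hD : ∀ b, b ≠ b₀ → D ≤ d ((p i).2 b)) :
    ∃ b, b ≠ b₀ ∧ D < d ((p j).2 b) :=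
  exists_gt_of_sameCell d v ε (hθ hij) b₀ hcell hdiff hD (hdom i) (hdom j)

/-- Along a dominant chain, a term whose classes off `b₀` all have maximal exponent freezes its cell in column `b₀`: every later term through
that cell has the same permutation and the same classes off `b₀`. [folklore] -/
theorem chain_eq_off_of_top (hθ : StrictMono θ) (hdom : ∀ k, IsDominant d v ε (θ k) (p k)) {i j : Fin (n + 1)}
    (hij : i < j) (b₀ : Fin m) (hcell : (p j).1 b₀ = (p i).1 b₀) (htop : ∀ b, b ≠ b₀ → ∀ l : Fin K, d l ≤ d ((p i).2 b)) :
    (p j).1 = (p i).1 ∧ ∀ b, b ≠ b₀ → (p j).2 b = (p i).2 b :=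
  eq_off_of_top d v ε (hθ hij) b₀ hcell htop (hdom i) (hdom j)

/-- Along a dominant chain, after a term whose classes off `b₀` all have maximal exponent, the transposition neighbour `σ * swap b b'`
(`b, b' ≠ b₀`, `b ≠ b'`) never occurs; at `m = 3` this is the retirement of the neighbour across the third column. [folklore] -/
theorem chain_ne_mul_swap_of_top (hθ : StrictMono θ) (hdom : ∀ k, IsDominant d v ε (θ k) (p k)) {i j : Fin (n + 1)}
    (hij : i < j) (b₀ b b' : Fin m) (hb : b ≠ b₀) (hb' : b' ≠ b₀) (hbb' : b ≠ b')
    (htop : ∀ c, c ≠ b₀ → ∀ l : Fin K, d l ≤ d ((p i).2 c)) : (p j).1 ≠ (p i).1 * Equiv.swap b b' :=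
  ne_mul_swap_of_top d v ε (hθ hij) b₀ b b' hb hb' hbb' htop (hdom i) (hdom j)

end Chain

end TopSticky

end Summit.ValiantsHypothesis.ValiantsHypothesis.Theorems.KPlusLogSqLaw
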